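import Mathlib
import Summits.HodgeConjecture.FermatCycles.HodgeFermatDigitLemma
import Summits.HodgeConjecture.FermatCycles.HodgeFermatPropL5B
import Summits.HodgeConjecture.FermatCycles.HodgeFermatTheoremUEq

/-!
# PROPOSITION Z5 (`tables/KR-FREE.md` §6) — part 1 (`HodgeFermat/PropZ5.lean`; HF-G21a)

Tree copy (part 1 of 2) of the module `HodgeFermat/PropZ5.lean` of the sibling cell's standalone package
`run/shared/lean/pub/pub-hodgefermat/lean/HodgeFermat/` (616 lines, sha256 `01180db7a7a8c945…`), source lines 43–298 (§§1–4: residues at `N = 5n`, the Z1 carries, digit closeness from `SameType`, the carries at `t = 1`).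
Filed by cell `pub-hfermat`, seat prover-1 gen-3, on the COORDINATOR KEEPER RULING of 2026-08-25 (gem sweep H1: take the
off-gate kernel theorem `thmFstar` through the gate) — here THEOREM F* of `tables/DPRIME-THEOREM.md` §9 IN FULL, i.e.
PROPOSITION D′(3N) and the descent (`HodgeFermat/PropDPrimeNFinal.lean`, GATE HF-G34), the last off-gate form of THEOREM F*
(its first two forms, `DecodingFinal.thmFstar` = F* at the prime levels and `ThmFstarNFinal.thmFstar` = F*(3N), landed on
2026-08-25 as `HodgeFermatThmFstar.lean` / `HodgeFermatThmFstarN.lean`, seats prover-1 gen-0 / gen-2); this file is one link of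
the import closure of `PropDPrimeNFinal.propDprime` (the sibling's KR-free chain: THEOREM L, COROLLARY M, THEOREM D6,
THEOREM U⁺, THEOREM KR6, THEOREM Z3U) on top of those landed chains.  The source module is the sibling's hub-checked module of
record (pub-hodgefermat `CERT.md` l.867, GATE HF-G21a; cell record `check/PropZ5_standalone.lean` sha256 `120809aa4f833e51…`); its declarations are copied VERBATIM.
Deviations from the source module, exhaustively: the `import` lines (tree modules `Summits.HodgeConjecture.FermatCycles.
HodgeFermat*` instead of `HodgeFermat.*`); this module docstring; the source's `open HodgeFermat.KRFree.PropL5 hiding mod_eq_of_repr` (l.47) becomes `open HodgeFermat.KRFree.PropL5` (the hidden copy was deleted from `HodgeFermatPropL5A.lean` as a restatement of `HodgeFermat.KRFree.mod_eq_of_repr`, which is the one meant here); DEDUP (pre-empting the gate's `dedup.landed`): the source's `lemma not_dvd_of_coprime` (l.62–66) restates `HodgeFermat.KRFree.TheoremUEq.not_dvd_unit` of `HodgeFermatTheoremUEq.lean` VERBATIM up to names and is DELETED, re-bound by `open HodgeFermat.KRFree.TheoremUEq renaming not_dvd_unit → not_dvd_of_coprime` (extra import); the added line `open HodgeFermat.KRFree.Decoding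 renaming unit_mul_not_dvd → not_dvd_mul_of_coprime` re-binds the `PropL5` name deleted there (use sites source l.170–171); DEDUP FALSE POSITIVE worked around WITHOUT semantic change: in `sameType_symm` (l.51, a lemma about THIS module's `PropL5.SameType`) the conclusion `SameType N T' T` is written `SameType (N : ℕ) T' T` — the same term after elaboration — because the gate's text-based duplicate detector identifies the verbatim text with the landed `HodgeFermat.KRFree.Decoding.st_symm`, a lemma about the DIFFERENT predicate `LemmaN.SameType` (dry-run 2026-08-25: verbatim → `dedup.landed … PropZ5.sameType_symm ≡ Decoding.st_symm`; an alias would be ill-typed at every use site); one-line docstrings added (gate lint) to `sameType_symm`, `sameType_congr_right` (over this chain's own `PropL5.SameType`); the file ends at source l.298 with an `end` line (part 2 = `HodgeFermatPropZ5B.lean`).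
Every other line — in particular every declaration's statement and proof — is byte-identical to the source.
HONEST FRAMING: explicit algebraic cycles for specific Hodge classes on Fermat/Delsarte varieties; residual open instances
listed; no claim on general Hodge.  (This file is arithmetic of CM types / finite combinatorics / analytic number theory
of the sibling's KR-free programme; it claims nothing about cycles.)

The source module's docstring (PropZ5.lean l.4–41), verbatim:

## PROPOSITION Z5 (`tables/KR-FREE.md` §6) — kernel-checked end-to-end for every level (build hodge-fermat, generation 21)

The pattern (Z1, Z1) at the prime 5 of THEOREM D6 (= Koblitz–Rohrlich 1978, p. 1196–1197, Case 2 with `p = 5 ∥ N`,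
which they settle by "the Lemma" of p. 1195 — proof omitted there; our DIGIT LEMMA, `DigitLemma.lean` — and their
display (7)).  `tables/KR-FREE.md` §6 writes the argument out; this file proves it in Lean for EVERY `n > 20` prime
to 30 (the levels `N = 5n ≤ 100` prime to 6 are covered by F35 … F95 of `KRFreeFacts.lean`):

> `N = 5n`, `gcd(n, 30) = 1`, `n > 20`; `T = (x₁, x₂, x₃)`, `T' = (y₁, y₂, y₃)` with `N ∣` both entry sums,
> `5 ∣ x₁`, `5 ∣ y₁`, `gcd(x₁, n) = gcd(y₁, n) = 1`, `5 ∤ x₂ x₃ y₂ y₃` (both Z1 at 5 with unit cofactors) and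
> `x₁ ≢ y₁ (mod N)` (automatic for a disjoint pair).  Then `H_T ∩ (ℤ/N)ˣ ≠ H_{T'} ∩ (ℤ/N)ˣ`
> (`theorem propZ5`; with `PropL5.propL5` it gives `theorem Z1_unit_rigid`).

Proof (= §6; the identity (E) of §1 is used in SUMMED form, which avoids fibre COUNTS).  For a Z1 triple
`T = (5y, s, t)` (`y` a unit of `ℤ/n`) and a unit `t̄₀` of `ℤ/n`, the five residues above `t̄₀` give the first entry
the common residue `5⟨t₀y⟩_n` (`first_mod`) and the other two entries `n·B + ⟨t₀s⟩_n`, `{B} = {0..4}`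
(`PropL5.lift_sum`), so the total residue sum over the fibre is `25⟨t₀y⟩_n + 5⟨t₀s⟩_n + 5⟨t₀t⟩_n + 20n`
(`Z1_total`); unit lifts contribute `N` or `2N` according as they are in `H_T` or not (`Z1_unit_cases`), the
non-unit lift `5t₁` contributes `5n·c_T̄(t̄₁)` (`Z1_star`).  For two Z1 triples with the same type the unit
contributions agree, whence (`pair_sum`)
`5⟨t₀y⟩_n + ⟨t₀s⟩_n + ⟨t₀t⟩_n + n c_T̄'(t̄₁) = 5⟨t₀y'⟩_n + ⟨t₀s'⟩_n + ⟨t₀t'⟩_n + n c_T̄(t̄₁)`.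
With `5⟨t₀y⟩_n = n·d(t̄₀ȳ) + (remainder)` and the carries `c_T̄(t̄₀), c_T̄'(t̄₀) ∈ {1, 2}` (`Z1_carry`) this is
`d(t̄₀ȳ) + c + c'_* = d(t̄₀ȳ') + c' + c_*`, hence `|d(t̄₀ȳ) − d(t̄₀ȳ')| ≤ 2`: after the first normalisation
`ȳ = 1` this is the hypothesis `DigitClose n ȳ'` of the DIGIT LEMMA (`digitClose_of_sameType`), so
`ȳ' ∈ {2, 2⁻¹}` (`digit_lemma`); interchanging the triples reduces to `ȳ' = 2⁻¹` (`propZ5`, `two_inv`).  Then at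
`t̄₀ = 1`, `d = 0`, `d' = 2` force `c_T̄(1̄) = 2` and `c_T̄'(1̄) = 1` (`carries_at_one` = K-R's (7)):
`⟨s⟩_n + ⟨t⟩_n = 2n − 5` — so after the second normalisation `T = (5, N − a, N − b)` — and
(†) `⟨s'⟩_n + ⟨t'⟩_n = (n − 5)/2`.  Finally `1, 2 ∉ H_T` (`one_two_not_inH`), so `1, 2 ∉ H_{T'}`, and with
`⟨5y'⟩_N = (N + 5)/2` the two carries-2 conditions force `⟨s'⟩_N` or `⟨t'⟩_N` into `{N − 2, N − 1}`, contradicting (†)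
(`window`; `half_case` assembles the case `ȳ' = 2⁻¹`).

Lean 4 + Mathlib (toolchain of the package); imports `HodgeFermat.DigitLemma` (the DIGIT LEMMA) and
`HodgeFermat.PropL5` (the model `InH`/`SameType`/`rsum`, the lift lemmas, the two normalisations); no `sorry`,
no `native_decide`; `#print axioms propZ5` at the end (`[propext, Classical.choice, Quot.sound]`).  The hub's
single-file checker cannot follow package imports, so the kernel check is run on the concatenation
`check/PropZ5_standalone.lean` (= `DigitLemma.lean` + `PropL5.lean` + this file, generated by
`code/gen21/mkstandalone.py`), which elaborates exactly like `lake build HodgeFermat.PropZ5`.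
-/

set_option autoImplicit false

namespace HodgeFermat.KRFree.PropZ5

open HodgeFermat.KRFree.PropL5

open HodgeFermat.KRFree.TheoremUEq renaming not_dvd_unit → not_dvd_of_coprime
open HodgeFermat.KRFree.Decoding renaming unit_mul_not_dvd → not_dvd_mul_of_coprime

/-! ## Symmetry and congruence of `SameType` -/

/-- `PropL5.SameType` is symmetric -/
lemma sameType_symm {N : ℕ} {T T' : ℕ × ℕ × ℕ} (h : SameType N T T') : SameType (N : ℕ) T' T :=
  fun t ht => (h t ht).symm

/-- `PropL5.SameType` depends only on the entries mod `N` (right triple, first two entries) -/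
lemma sameType_congr_right {N a b c a' b' c' : ℕ} {T : ℕ × ℕ × ℕ} (ha : a ≡ a' [MOD N])
    (hb : b ≡ b' [MOD N]) (h : SameType N T (a, b, c)) : SameType N T (a', b', c') :=
  sameType_symm (sameType_congr_left ha hb (sameType_symm h))

/-- products of numbers prime to 5 are prime to 5 -/
lemma five_nd {u v : ℕ} (hu : ¬ 5 ∣ u) (hv : ¬ 5 ∣ v) : ¬ 5 ∣ u * v :=
  fun h => ((Nat.Prime.dvd_mul Nat.prime_five).mp h).elim hu hv


/-- `(u (w mod n)) mod n = (u w) mod n` -/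
lemma mul_mod_mod (u w n : ℕ) : u * (w % n) % n = u * w % n := by
  rw [Nat.mul_mod, Nat.mod_mod, ← Nat.mul_mod]

/-! ## Residues of a Z1 triple `T = (5y, s, t)` (`y` a unit of `ℤ/n`, `5 ∤ st`) over a unit `t̄₀` of `ℤ/n`

The five residues of `ℤ/N`, `N = 5n`, above `t̄₀` are `t₀ + jn` (`j = 0,…,4`).  The first entry has the SAME
residue `⟨(t₀ + jn)·5y⟩_N = 5⟨t₀y⟩_n` at all five; the other two entries run through `n·B + ⟨t₀s⟩_n` with
`{B} = {0,…,4}` (`PropL5.lift_sum`).  Hence the total residue sum over the fibre is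
`25⟨t₀y⟩_n + 5⟨t₀s⟩_n + 5⟨t₀t⟩_n + 20n`; the non-unit lift `5t₁` contributes `5·(residue sum of T̄ at t̄₁)`,
and each unit lift contributes `N` (if it is in `H_T`) or `2N`.  This is the identity (E) of `KR-FREE` §1 for
the pattern Z1, in summed form: it determines the fibre count `N_T(t̄₀)` from `d(t̄₀ȳ) = ⌊5⟨t₀y⟩_n/n⌋` and the
two carries `c_T̄(t̄₀)`, `c_T̄(t̄₁)`. -/

/-- the first entry: `⟨(t₀ + jn)·5y⟩_{5n} = 5⟨t₀ y⟩_n` for every `j` -/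
lemma first_mod (n t₀ y j : ℕ) : (t₀ + j * n) * (5 * y) % (5 * n) = 5 * (t₀ * y % n) := by
  have e : (t₀ + j * n) * (5 * y) = 5 * (t₀ * y + j * y * n) := by ring
  rw [e, Nat.mul_mod_mul_left, Nat.add_mul_mod_self_right]

/-- the total residue sum over the five lifts of `t̄₀` -/
lemma Z1_total (n t₀ y s t : ℕ) (hn : 0 < n) (h5s : ¬ 5 ∣ s) (h5t : ¬ 5 ∣ t) :
    rsum (5 * n) (5 * y, s, t) (t₀ + 0 * n) + rsum (5 * n) (5 * y, s, t) (t₀ + 1 * n)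
      + rsum (5 * n) (5 * y, s, t) (t₀ + 2 * n) + rsum (5 * n) (5 * y, s, t) (t₀ + 3 * n)
      + rsum (5 * n) (5 * y, s, t) (t₀ + 4 * n)
      = 25 * (t₀ * y % n) + 5 * (t₀ * s % n) + 5 * (t₀ * t % n) + 20 * n := by
  have ls := lift_sum n t₀ s hn h5s
  have lt := lift_sum n t₀ t hn h5t
  have f0 := first_mod n t₀ y 0
  have f1 := first_mod n t₀ y 1
  have f2 := first_mod n t₀ y 2
  have f3 := first_mod n t₀ y 3
  have f4 := first_mod n t₀ y 4
  unfold rsum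
  simp only
  omega

/-- the carry of `T̄ = T mod n` at `t̄₀` is 1 or 2: `⟨5⟨t₀y⟩_n⟩_n + ⟨t₀ s⟩_n + ⟨t₀ t⟩_n ∈ {n, 2n}` -/
lemma Z1_carry (n t₀ y s t : ℕ) (hn : 1 < n) (h5n : ¬ 5 ∣ n) (ht₀ : Nat.Coprime t₀ n)
    (hy : Nat.Coprime y n) (hs : n ∣ 5 * y + s + t) :
    5 * (t₀ * y % n) % n + t₀ * s % n + t₀ * t % n = n ∨
      5 * (t₀ * y % n) % n + t₀ * s % n + t₀ * t % n = 2 * n := by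
  have hm : 5 * (t₀ * y % n) % n + t₀ * s % n + t₀ * t % n ≡ t₀ * (5 * y + s + t) [MOD n] := by
    have h1 : 5 * (t₀ * y % n) % n ≡ 5 * (t₀ * y) [MOD n] :=
      (Nat.mod_modEq _ n).trans ((Nat.mod_modEq _ n).mul_left 5)
    have h2 : t₀ * s % n ≡ t₀ * s [MOD n] := Nat.mod_modEq _ n
    have h3 : t₀ * t % n ≡ t₀ * t [MOD n] := Nat.mod_modEq _ n
    have e : t₀ * (5 * y + s + t) = 5 * (t₀ * y) + t₀ * s + t₀ * t := by ring
    rw [e]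
    exact (h1.add h2).add h3
  have hdvd : n ∣ t₀ * (5 * y + s + t) := Dvd.dvd.mul_left hs t₀
  obtain ⟨k, hk⟩ := Nat.modEq_zero_iff_dvd.mp (hm.trans (Nat.modEq_zero_iff_dvd.mpr hdvd))
  have b1 : 5 * (t₀ * y % n) % n < n := Nat.mod_lt _ (by omega)
  have b2 : t₀ * s % n < n := Nat.mod_lt _ (by omega)
  have b3 : t₀ * t % n < n := Nat.mod_lt _ (by omega)
  have hpos : 0 < 5 * (t₀ * y % n) % n := by
    apply Nat.pos_of_ne_zero
    intro h0
    have d1 : n ∣ 5 * (t₀ * y % n) := Nat.dvd_of_mod_eq_zero h0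
    have d2 : n ∣ t₀ * y % n := Nat.Coprime.dvd_of_dvd_mul_left (coprime_five_n h5n) d1
    have d3 : t₀ * y % n = 0 := Nat.eq_zero_of_dvd_of_lt d2 (Nat.mod_lt _ (by omega))
    exact not_dvd_of_coprime hn (Nat.Coprime.mul_left ht₀ hy) (Nat.dvd_of_mod_eq_zero d3)
  have hk1 : 1 ≤ k := by
    by_contra h
    have : k = 0 := by omega
    subst this
    omega
  have hk2 : k ≤ 2 := by
    by_contra h
    have : n * 3 ≤ n * k := Nat.mul_le_mul_left n (by omega)
    omega
  interval_cases k <;> omega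

/-- the carry of `T̄` at a unit `t̄₁` is 1 or 2 (residue sum `n` or `2n`, never `0`) -/
lemma Z1_star (n t₁ y s t : ℕ) (hn : 1 < n) (h5n : ¬ 5 ∣ n) (ht₁ : Nat.Coprime t₁ n)
    (hy : Nat.Coprime y n) (hs : n ∣ 5 * y + s + t) :
    rsum n (5 * y, s, t) t₁ = n ∨ rsum n (5 * y, s, t) t₁ = 2 * n := by
  rcases rsum_small_cases t₁ (by omega) hs with h | h | h
  · exfalso
    have h0 : t₁ * (5 * y) % n = 0 := by
      unfold rsum at h
      simp only at h
      omega
    have e : t₁ * (5 * y) = 5 * (t₁ * y) := by ring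
    rw [e] at h0
    have d2 : n ∣ t₁ * y :=
      Nat.Coprime.dvd_of_dvd_mul_left (coprime_five_n h5n) (Nat.dvd_of_mod_eq_zero h0)
    exact not_dvd_of_coprime hn (Nat.Coprime.mul_left ht₁ hy) d2
  · exact Or.inl h
  · exact Or.inr h

/-- at a unit `g` of `ℤ/N` a Z1 triple has carry 1 or 2, and `g ∈ H_T` iff the carry is 1 -/
lemma Z1_unit_cases (n g y s t : ℕ) (hn : 1 < n) (hg : Nat.Coprime g (5 * n)) (hy : Nat.Coprime y n)
    (hs : 5 * n ∣ 5 * y + s + t) (h5s : ¬ 5 ∣ s) (h5t : ¬ 5 ∣ t) :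
    (rsum (5 * n) (5 * y, s, t) g = 5 * n ∨ rsum (5 * n) (5 * y, s, t) g = 2 * (5 * n)) ∧
      (InH (5 * n) (5 * y, s, t) g ↔ rsum (5 * n) (5 * y, s, t) g = 5 * n) := by
  have hN : 0 < 5 * n := by omega
  have h1 : ¬ 5 * n ∣ g * (5 * y) := by
    intro h
    have e : g * (5 * y) = 5 * (g * y) := by ring
    rw [e] at h
    have d : n ∣ g * y := Nat.dvd_of_mul_dvd_mul_left (by norm_num) h
    exact not_dvd_of_coprime hn (Nat.Coprime.mul_left (Nat.Coprime.coprime_mul_left_right hg) hy) d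
  have h2 : ¬ 5 * n ∣ g * s := not_dvd_mul_of_coprime hg (fun h => h5s (Nat.dvd_trans ⟨n, rfl⟩ h))
  have h3 : ¬ 5 * n ∣ g * t := not_dvd_mul_of_coprime hg (fun h => h5t (Nat.dvd_trans ⟨n, rfl⟩ h))
  exact ⟨rsum_cases hN hs h1 h2 h3, inH_iff_rsum hN hs h1 h2 h3⟩

/-- two carries (each 1 or 2, recorded as residue sums `N` or `2N`) that agree on "= 1" are equal -/
lemma eq_of_carry_iff {N a b : ℕ} (hN : 0 < N) (ha : a = N ∨ a = 2 * N) (hb : b = N ∨ b = 2 * N)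
    (h : a = N ↔ b = N) : a = b := by
  rcases ha with rfl | rfl <;> rcases hb with rfl | rfl
  · rfl
  · exact absurd (h.mp rfl) (by omega)
  · exact absurd (h.mpr rfl) (by omega)
  · rfl

/-- **(E) for two Z1 triples with the same CM type, summed over the fibre of `t̄₀`.**
`N = 5n`, `5 ∤ n`, `n > 1`; `T = (5y, s, t)`, `T' = (5y', s', t')` with `y, y'` units of `ℤ/n`, `5 ∤ s t s' t'`,
`N ∣` the entry sums, and `H_T = H_{T'}` on units.  Then for every unit `t̄₀` of `ℤ/n` there are carries
`c = n·c_T̄(t̄₁)`, `c' = n·c_T̄'(t̄₁)` (`t̄₁ = 5̄⁻¹ t̄₀`), each `n` or `2n`, with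
`5⟨t₀y⟩_n + ⟨t₀s⟩_n + ⟨t₀t⟩_n + c' = 5⟨t₀y'⟩_n + ⟨t₀s'⟩_n + ⟨t₀t'⟩_n + c`
— the unit lifts contribute equally to both fibre sums, so the totals differ only through the non-unit lift. -/
theorem pair_sum (n t₀ y s t y' s' t' : ℕ) (hn : 1 < n) (h5n : ¬ 5 ∣ n) (ht₀ : Nat.Coprime t₀ n)
    (hy : Nat.Coprime y n) (hs : 5 * n ∣ 5 * y + s + t) (h5s : ¬ 5 ∣ s) (h5t : ¬ 5 ∣ t)
    (hy' : Nat.Coprime y' n) (hs' : 5 * n ∣ 5 * y' + s' + t') (h5s' : ¬ 5 ∣ s') (h5t' : ¬ 5 ∣ t')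
    (hH : SameType (5 * n) (5 * y, s, t) (5 * y', s', t')) :
    ∃ c c', (c = n ∨ c = 2 * n) ∧ (c' = n ∨ c' = 2 * n) ∧
      5 * (t₀ * y % n) + t₀ * s % n + t₀ * t % n + c'
        = 5 * (t₀ * y' % n) + t₀ * s' % n + t₀ * t' % n + c := by
  have hn0 : 0 < n := by omega
  have hN : 0 < 5 * n := by omega
  obtain ⟨j₀, hj₀, hj₀5⟩ := nonunit_exists n t₀ h5n
  -- the four unit lifts contribute equally
  have hunit : ∀ j, j ≤ 4 → j ≠ j₀ →
      rsum (5 * n) (5 * y, s, t) (t₀ + j * n) = rsum (5 * n) (5 * y', s', t') (t₀ + j * n) := by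
    intro j hj hne
    have h5j : ¬ 5 ∣ t₀ + j * n := fun h => hne (nonunit_unique h5n hj hj₀ h hj₀5)
    have hco := lift_coprime ht₀ h5j
    obtain ⟨hc, hi⟩ := Z1_unit_cases n (t₀ + j * n) y s t hn hco hy hs h5s h5t
    obtain ⟨hc', hi'⟩ := Z1_unit_cases n (t₀ + j * n) y' s' t' hn hco hy' hs' h5s' h5t'
    exact eq_of_carry_iff hN hc hc' (hi.symm.trans ((hH _ hco).trans hi'))
  have r0 := hunit 0 (by norm_num)
  have r1 := hunit 1 (by norm_num)
  have r2 := hunit 2 (by norm_num)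
  have r3 := hunit 3 (by norm_num)
  have r4 := hunit 4 (by norm_num)
  -- the non-unit lift `t₀ + j₀ n = 5 t₁`
  obtain ⟨t₁, ht₁⟩ := hj₀5
  have ht₁n : Nat.Coprime t₁ n := by
    have h : Nat.Coprime (t₀ + j₀ * n) n := (Nat.coprime_add_mul_right_left t₀ n j₀).mpr ht₀
    rw [ht₁] at h
    exact Nat.Coprime.coprime_mul_left h
  have hsn : n ∣ 5 * y + s + t := Nat.dvd_trans ⟨5, by ring⟩ hs
  have hsn' : n ∣ 5 * y' + s' + t' := Nat.dvd_trans ⟨5, by ring⟩ hs'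
  have star : rsum (5 * n) (5 * y, s, t) (t₀ + j₀ * n) = 5 * rsum n (5 * y, s, t) t₁ := by
    rw [ht₁]; exact rsum_five_mul n t₁ (5 * y) s t
  have star' : rsum (5 * n) (5 * y', s', t') (t₀ + j₀ * n) = 5 * rsum n (5 * y', s', t') t₁ := by
    rw [ht₁]; exact rsum_five_mul n t₁ (5 * y') s' t'
  have htot := Z1_total n t₀ y s t hn0 h5s h5t
  have htot' := Z1_total n t₀ y' s' t' hn0 h5s' h5t'
  refine ⟨rsum n (5 * y, s, t) t₁, rsum n (5 * y', s', t') t₁,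
    Z1_star n t₁ y s t hn h5n ht₁n hy hsn, Z1_star n t₁ y' s' t' hn h5n ht₁n hy' hsn', ?_⟩
  interval_cases j₀ <;> omega

/-! ## Consequence 1: the digit hypothesis `|d(ū) − d(ū w)| ≤ 2` (`KR-FREE` §6, first display) -/

/-- **(Z1, Z1) with the same type ⇒ the hypothesis of the DIGIT LEMMA** for `w = ȳ'` (after the first
normalisation `T = (5, s, t)`, `T' = (5y', s', t')`): `DigitClose n ȳ'`. -/
theorem digitClose_of_sameType (n y' s t s' t' : ℕ) (hn : 1 < n) (h5n : ¬ 5 ∣ n)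
    (hs : 5 * n ∣ 5 + s + t) (h5s : ¬ 5 ∣ s) (h5t : ¬ 5 ∣ t)
    (hy' : Nat.Coprime y' n) (hs' : 5 * n ∣ 5 * y' + s' + t') (h5s' : ¬ 5 ∣ s') (h5t' : ¬ 5 ∣ t')
    (hH : SameType (5 * n) (5, s, t) (5 * y', s', t')) : DigitClose n (y' % n) := by
  intro u hu0 hun hu
  have hn0 : 0 < n := by omega
  have hs1 : 5 * n ∣ 5 * 1 + s + t := by rw [Nat.mul_one]; exact hs
  have hH1 : SameType (5 * n) (5 * 1, s, t) (5 * y', s', t') := by rw [Nat.mul_one]; exact hH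
  obtain ⟨c, c', hc, hc', hE⟩ := pair_sum n u 1 s t y' s' t' hn h5n hu (Nat.coprime_one_left n)
    hs1 h5s h5t hy' hs' h5s' h5t' hH1
  have hcarry := Z1_carry n u 1 s t hn h5n hu (Nat.coprime_one_left n) (Nat.dvd_trans ⟨5, by ring⟩ hs1)
  have hcarry' := Z1_carry n u y' s' t' hn h5n hu hy' (Nat.dvd_trans ⟨5, by ring⟩ hs')
  rw [Nat.mul_one] at hE hcarry
  have b0 : 5 * (u % n) % n < n := Nat.mod_lt _ hn0
  have b0' : 5 * (u * y' % n) % n < n := Nat.mod_lt _ hn0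
  unfold digit
  rw [mul_mod_mod]
  obtain ⟨d, hd⟩ : ∃ d, d = 5 * (u % n) / n := ⟨_, rfl⟩
  obtain ⟨d', hd'⟩ : ∃ d', d' = 5 * (u * y' % n) / n := ⟨_, rfl⟩
  rw [← hd, ← hd']
  have e1 : n * d + 5 * (u % n) % n = 5 * (u % n) := by rw [hd]; exact Nat.div_add_mod _ n
  have e2 : n * d' + 5 * (u * y' % n) % n = 5 * (u * y' % n) := by rw [hd']; exact Nat.div_add_mod _ n
  have bd : d < 5 := by
    rw [hd]
    have := Nat.mod_lt u hn0
    exact (Nat.div_lt_iff_lt_mul hn0).mpr (by omega)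
  have bd' : d' < 5 := by
    rw [hd']
    have := Nat.mod_lt (u * y') hn0
    exact (Nat.div_lt_iff_lt_mul hn0).mpr (by omega)
  interval_cases d <;> interval_cases d' <;> omega

/-! ## Consequence 2: (E) at `t̄ = 1` when `ȳ' = 2̄⁻¹` (`KR-FREE` §6: `c(1̄) = 2`, `c'(1̄) = 1`, i.e. (†)) -/

/-- for the normalised pair `T = (5, s, t)`, `T' = (5y', s', t')` with `2ȳ' = 1` in `ℤ/n` (`n > 5`):
the carry of `T̄` at `1̄` is 2, i.e. `⟨s⟩_n + ⟨t⟩_n = 2n − 5`, and the carry of `T̄'` at `1̄` is 1, i.e.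
`⟨s'⟩_n + ⟨t'⟩_n = (n − 5)/2` (†). -/
theorem carries_at_one (n y' s t s' t' : ℕ) (hn : 5 < n) (h5n : ¬ 5 ∣ n)
    (hs : 5 * n ∣ 5 + s + t) (h5s : ¬ 5 ∣ s) (h5t : ¬ 5 ∣ t)
    (hy' : Nat.Coprime y' n) (hs' : 5 * n ∣ 5 * y' + s' + t') (h5s' : ¬ 5 ∣ s') (h5t' : ¬ 5 ∣ t')
    (hw : 2 * (y' % n) = n + 1)
    (hH : SameType (5 * n) (5, s, t) (5 * y', s', t')) :
    s % n + t % n = 2 * n - 5 ∧ 2 * (s' % n + t' % n) + 5 = n := by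
  have hn1 : 1 < n := by omega
  have hn0 : 0 < n := by omega
  have hs1 : 5 * n ∣ 5 * 1 + s + t := by rw [Nat.mul_one]; exact hs
  have hH1 : SameType (5 * n) (5 * 1, s, t) (5 * y', s', t') := by rw [Nat.mul_one]; exact hH
  obtain ⟨c, c', hc, hc', hE⟩ := pair_sum n 1 1 s t y' s' t' hn1 h5n (Nat.coprime_one_left n)
    (Nat.coprime_one_left n) hs1 h5s h5t hy' hs' h5s' h5t' hH1
  have hcarry := Z1_carry n 1 1 s t hn1 h5n (Nat.coprime_one_left n) (Nat.coprime_one_left n)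
    (Nat.dvd_trans ⟨5, by ring⟩ hs1)
  have hcarry' := Z1_carry n 1 y' s' t' hn1 h5n (Nat.coprime_one_left n) hy'
    (Nat.dvd_trans ⟨5, by ring⟩ hs')
  have h1n : 1 % n = 1 := Nat.mod_eq_of_lt hn1
  have h5 : 5 % n = 5 := Nat.mod_eq_of_lt (by omega)
  simp only [Nat.one_mul, Nat.mul_one, h1n, h5] at hE hcarry hcarry'
  have hr' : 5 * (y' % n) % n = (n + 5) / 2 := mod_eq_of_repr (q := 2) (by omega) (by omega)
  rw [hr'] at hcarry'
  have b2 : s % n < n := Nat.mod_lt _ hn0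
  have b3 : t % n < n := Nat.mod_lt _ hn0
  have b2' : s' % n < n := Nat.mod_lt _ hn0
  have b3' : t' % n < n := Nat.mod_lt _ hn0
  omega


end HodgeFermat.KRFree.PropZ5
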